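import Literature.MathematicalPhysics.QuantumLattice.DWaveSourceNNNHoppingFlatTwistCusp
import Literature.MathematicalPhysics.QuantumLattice.DWaveSourceLeeYang
import HarnessLib

/-!
# The flat-twisted pair-sourced `t–t'` ground energy is EVEN in the source; `e_src^tw(·;κ)` is even; and
# Fulde–Ferrell / pair-density-wave order at bond phase `κ` IS non-differentiability of `e_src^tw(·;κ)` at zero source

Topic `Literature/MathematicalPhysics/QuantumLattice` (namespace = path; family `hubbard`). The twisted twin of
`DWaveSourceNNNHoppingGroundEnergyEven.lean` (untwisted torus: `E₀(A_L(−h)) = E₀(A_L(h))`, `e_src` even, and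
`HasDWaveOrderTT' ↔ ¬ DifferentiableAt e_src 0`), for the T8 object `dWaveSourceTorusTT'Twist L t' U μ h n` and its
thermodynamic dictionary (`dWaveSourceEnergyDensityTT'Twist` = `e^tw(·;κ)`, `dWaveOrderParameterTT'Twist` = `m⋆_κ`, the
cusp of `e^tw(·;κ)`; `DWaveSourceNNNHoppingFlatTwistCusp.lean`). The source `−h(Δ_d + Δ_d†)` changes the particle
number by `∓2` while the TWISTED hopping (both nearest- and next-nearest-neighbour Peierls terms) and `μN` conserve it,
so the gauge rotation `e^{iπN/2}` maps the twisted torus at `h` to the one at `−h`.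

* §1 `groundEnergy_dWaveSourceTorusTT'Twist_neg_source` — `E₀(twist n, −h) = E₀(twist n, h)` on every torus
  (`diagonal_card_commutator_hubbardTorusTT'Twist_sub_mu`: `[N, H^{tt'}_{twist} − μN] = 0`, from
  `preservesSectors_hubbardTorusTT'Twist`).
* §2 `dWaveSourceEnergyDensityTT'Twist_even` — `e^tw(t',U,μ,−h;κ) = e^tw(t',U,μ,h;κ)` for every `κ` realised on a
  trivial-holonomy sequence; `e^tw(·;κ)` is largest at `h = 0` and non-increasing in `|h|`; windows transport across
  the sign of the source.
* §3 THE TWO-SIDED CUSP: the right slope of `e^tw(·;κ)` at `0` tends to `−2m⋆_κ`, the left slope to `+2m⋆_κ`;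
  `HasDerivAt (e^tw(·;κ)) e′ 0 ↔ e′ = 0 ∧ m⋆_κ = 0`; hence **`0 < m⋆_κ ↔ ¬ DifferentiableAt ℝ (e^tw(·;κ)) 0`** — PDW
  order at bond phase `κ` is the KINK of the twisted sourced energy density at zero source (the «PC-c = PC-a»
  identity for pair-density-wave order); `m⋆_κ = 0 ↔ HasDerivAt (e^tw(·;κ)) 0 0`.

HONEST SCOPE: identities; nothing here decides whether any `m⋆_κ` is positive; no number, not a phase sentence.
Everything is PROVED; no definition, no named fact.

## References
* T. Koma, H. Tasaki, J. Stat. Phys. 76 (1994) 745, §1 (sourced Hamiltonians; `U(1)` gauge rotations).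
  [cite: KomaTasaki1994, §1]
* R. B. Griffiths, Phys. Rev. 152 (1966) 240, §II (one-sided derivatives and the order parameter).
  [cite: Griffiths1966, §II]
* H. Watanabe, J. Stat. Phys. 177 (2019) 717, §2.2.1 (flat twists conserve the particle number). [cite: Watanabe2019, §2.2.1]
-/

noncomputable section

namespace Literature.MathematicalPhysics.QuantumLattice

open Matrix Filter Set Literature.Probability.LatticeModels HubbardWave0
open scoped Topology

/-! ### Similarity invariance of the ground energy -/

section Similarity

variable {m : Type*} [Fintype m] [DecidableEq m]

/-- `E₀(W A W′) = E₀(A)` whenever `W W′ = 1 = W′ W` (the spectrum is invariant under conjugation by a unit).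
[folklore] -/
private theorem groundEnergy_conj_of_mul_eq_one'' {A W W' : Matrix m m ℂ} (hWW' : W * W' = 1)
    (hW'W : W' * W = 1) : (W * A * W').groundEnergy = A.groundEnergy := by
  set u : (Matrix m m ℂ)ˣ := ⟨W, W', hWW', hW'W⟩
  have hspec : spectrum ℂ (W * A * W') = spectrum ℂ A := spectrum.units_conjugate (u := u)
  unfold Matrix.groundEnergy ContinuousLinearMap.groundEnergy
  rw [spectrum_toEuclideanCLM, spectrum_toEuclideanCLM, hspec]

end Similarity

/-! ### §1 Evenness of the twisted sourced ground energy in the source -/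

section Even

variable (L : ℕ) [NeZero L]

/-- `[N, H^{tt'}_{twist n} − μN] = 0`, in diagonal form (both Peierls hopping terms conserve `N↑` and `N↓`).
[cite: Watanabe2019, §2.2.1] -/
theorem diagonal_card_commutator_hubbardTorusTT'Twist_sub_mu (tp U μ : ℝ) (n : Fin 2 → ZMod L) :
    diagonal (fun s : Finset (Orb (FermionTorus 2 L)) => (s.card : ℂ)) *
        (hubbardTorusTT'Twist L tp U n - (μ : ℂ) • totalNumber) -
      (hubbardTorusTT'Twist L tp U n - (μ : ℂ) • totalNumber) * diagonal (fun s => (s.card : ℂ)) = 0 := by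
  have hH : Commute (hubbardTorusTT'Twist L tp U n) (diagonal fun s : Finset (Orb (FermionTorus 2 L)) => (s.card : ℂ)) := by
    have h0 := (preservesSectors_hubbardTorusTT'Twist L tp U n).commute_diagonal fun a b : ℕ => ((a + b : ℕ) : ℂ)
    -- the two `diagonal`s carry different (propositionally equal) `DecidableEq` instances; the entries agree by
    -- `#s = #up s + #down s`
    convert h0 using 2
    funext s
    rw [card_eq_upPart_add_downPart s]
  have hN : Commute ((μ : ℂ) • (totalNumber : Matrix (Finset (Orb (FermionTorus 2 L))) (Finset (Orb (FermionTorus 2 L))) ℂ))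
      (diagonal fun s : Finset (Orb (FermionTorus 2 L)) => (s.card : ℂ)) := by
    rw [totalNumber_torus_eq_diagonal]
    exact (Commute.refl _).smul_left _
  exact sub_eq_zero.2 (hH.sub_left hN).eq.symm

/-- **The twisted sourced ground energy is even in the source**:
`E₀(dWaveSourceTorusTT'Twist L t' U μ (−h) n) = E₀(dWaveSourceTorusTT'Twist L t' U μ h n)` for every real `h` and
every twist `n` (gauge rotation `e^{iπN/2}`: it fixes `H^{tt'}_{twist} − μN` and flips the sign of `Δ_d + Δ_d†`).
[cite: KomaTasaki1994, §1] -/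
theorem groundEnergy_dWaveSourceTorusTT'Twist_neg_source (tp U μ h : ℝ) (n : Fin 2 → ZMod L) :
    (dWaveSourceTorusTT'Twist L tp U μ (-h) n).groundEnergy = (dWaveSourceTorusTT'Twist L tp U μ h n).groundEnergy := by
  set d : Finset (Orb (FermionTorus 2 L)) → ℂ := fun s => (s.card : ℂ) with hd
  set c : ℂ := (Real.pi : ℂ) / 2 * Complex.I with hc
  set W : Matrix (Finset (Orb (FermionTorus 2 L))) (Finset (Orb (FermionTorus 2 L))) ℂ :=
    diagonal fun s => Complex.exp (c * d s) with hW
  set W' : Matrix (Finset (Orb (FermionTorus 2 L))) (Finset (Orb (FermionTorus 2 L))) ℂ :=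
    diagonal fun s => Complex.exp (-(c * d s)) with hW'
  have hWW' : W * W' = 1 := diagonal_exp_mul_diagonal_exp_neg d c
  have hW'W : W' * W = 1 := by
    rw [hW, hW', diagonal_mul_diagonal, ← diagonal_one]
    congr 1
    funext s
    rw [← Complex.exp_add, neg_add_cancel, Complex.exp_zero]
  have hc2 : Complex.exp (c * 2) = -1 := by
    rw [hc, show (Real.pi : ℂ) / 2 * Complex.I * 2 = Real.pi * Complex.I by ring]
    exact Complex.exp_pi_mul_I
  have hcm2 : Complex.exp (c * -2) = -1 := by
    have h1 : Complex.exp (c * -2) * Complex.exp (c * 2) = 1 := by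
      rw [← Complex.exp_add]
      ring_nf
      exact Complex.exp_zero
    rw [hc2] at h1
    linear_combination -h1
  -- the rotation fixes `H^{tt'}_{twist} − μN` …
  have hcH : W * (hubbardTorusTT'Twist L tp U n - (μ : ℂ) • totalNumber) * W' =
      hubbardTorusTT'Twist L tp U n - (μ : ℂ) • totalNumber := by
    have key := conj_eq_smul_of_grading d (A := hubbardTorusTT'Twist L tp U n - (μ : ℂ) • totalNumber) (q := 0)
      (by simpa using diagonal_card_commutator_hubbardTorusTT'Twist_sub_mu L tp U μ n) c
    rw [hW, hW', key]
    simp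
  -- … and flips the source `Δ_d + Δ_d†`
  have hcQ : W * (pairField dWaveFormFactor L + (pairField dWaveFormFactor L)ᴴ) * W' =
      -(pairField dWaveFormFactor L + (pairField dWaveFormFactor L)ᴴ) := by
    rw [hW, hW', Matrix.mul_add, Matrix.add_mul,
      conj_eq_smul_of_grading d (diagonal_card_commutator_pairField L) c,
      conj_eq_smul_of_grading d (diagonal_card_commutator_pairField_conjTranspose L) c, hcm2, hc2,
      neg_one_smul, neg_one_smul, neg_add]
  have hconj : W * dWaveSourceTorusTT'Twist L tp U μ h n * W' = dWaveSourceTorusTT'Twist L tp U μ (-h) n := by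
    rw [dWaveSourceTorusTT'Twist_eq_sub_smul, dWaveSourceTorusTT'Twist_eq_sub_smul, Matrix.mul_sub, Matrix.sub_mul,
      hcH, Matrix.mul_smul, Matrix.smul_mul, hcQ, Complex.ofReal_neg, smul_neg, neg_smul]
  rw [← hconj, groundEnergy_conj_of_mul_eq_one'' hWW' hW'W]

/-- Hence the twisted response density is ODD up to the ground-space convention? No — only the ENERGY statement is
used downstream; as a corollary of evenness, the sourced gain of the twisted torus is even too:
`E₀(twist, 0) − E₀(twist, −h) = E₀(twist, 0) − E₀(twist, h)`. [cite: KomaTasaki1994, §1] -/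
theorem groundEnergy_dWaveSourceTorusTT'Twist_gain_even (tp U μ h : ℝ) (n : Fin 2 → ZMod L) :
    (dWaveSourceTorusTT'Twist L tp U μ 0 n).groundEnergy - (dWaveSourceTorusTT'Twist L tp U μ (-h) n).groundEnergy =
      (dWaveSourceTorusTT'Twist L tp U μ 0 n).groundEnergy - (dWaveSourceTorusTT'Twist L tp U μ h n).groundEnergy := by
  rw [groundEnergy_dWaveSourceTorusTT'Twist_neg_source]

end Even

/-! ### §2 The thermodynamic-limit twisted energy density is even in the source -/

section Limit

variable (t' U μ : ℝ) (κ : Fin 2 → Circle) (Ls : ℕ → ℕ) [∀ j, NeZero (Ls j)] (hLs : Tendsto Ls atTop atTop)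
  (n : ∀ j, Fin 2 → ZMod (Ls j)) (hn : ∀ j i, ZMod.toCircle (n j i) = κ i)

include hLs hn in
/-- **`e^tw(t',U,μ,−h;κ) = e^tw(t',U,μ,h;κ)`** for every real `h` and every `κ` realised on a trivial-holonomy
sequence. [cite: KomaTasaki1994, §1] -/
theorem dWaveSourceEnergyDensityTT'Twist_even (h : ℝ) :
    dWaveSourceEnergyDensityTT'Twist t' U μ (-h) κ = dWaveSourceEnergyDensityTT'Twist t' U μ h κ := by
  refine tendsto_nhds_unique (tendsto_groundEnergy_dWaveSourceTorusTT'Twist_div_sq t' U μ (-h) κ Ls hLs n hn) ?_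
  simp only [groundEnergy_dWaveSourceTorusTT'Twist_neg_source]
  exact tendsto_groundEnergy_dWaveSourceTorusTT'Twist_div_sq t' U μ h κ Ls hLs n hn

include hLs hn in
/-- `e^tw(·;κ)` is non-increasing on `[0, ∞)` (concave with maximum at `0`). [cite: KomaTasaki1994, §1] -/
theorem dWaveSourceEnergyDensityTT'Twist_anti {h h' : ℝ} (hh : 0 ≤ h) (hle : h ≤ h') :
    dWaveSourceEnergyDensityTT'Twist t' U μ h' κ ≤ dWaveSourceEnergyDensityTT'Twist t' U μ h κ := by
  rcases hle.eq_or_lt with rfl | hlt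
  · exact le_rfl
  rcases hh.eq_or_lt with rfl | hpos
  · exact dWaveSourceEnergyDensityTT'Twist_le_zero_field_twist t' U μ h' κ Ls hLs n hn
  -- concavity: the secant from `0` is non-decreasing, and both secants are ≥ 0
  have hmono := SourceSandwich.monotoneOn_slope_of_concaveOn
    ((concaveOn_dWaveSourceEnergyDensityTT'Twist t' U μ κ Ls hLs n hn).subset (Set.subset_univ _) (convex_Ici 0))
  have key := hmono (Set.mem_Ioi.2 hpos) (Set.mem_Ioi.2 (hpos.trans hlt)) hle
  dsimp only at key
  have hpos' : 0 < h' := hpos.trans hlt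
  have h0 := dWaveSourceEnergyDensityTT'Twist_le_zero_field_twist t' U μ h κ Ls hLs n hn
  rw [div_le_div_iff₀ (by positivity) (by positivity)] at key
  nlinarith [key, mul_nonneg (sub_nonneg.2 hlt.le) (sub_nonneg.2 h0), hpos, hpos']

include hLs hn in
/-- **`e^tw(·;κ)` is non-increasing in `|h|`**: `|h| ≤ |h'| ⇒ e^tw(h';κ) ≤ e^tw(h;κ)`. [cite: KomaTasaki1994, §1] -/
theorem dWaveSourceEnergyDensityTT'Twist_anti_abs {h h' : ℝ} (hle : |h| ≤ |h'|) :
    dWaveSourceEnergyDensityTT'Twist t' U μ h' κ ≤ dWaveSourceEnergyDensityTT'Twist t' U μ h κ := by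
  have key : ∀ x : ℝ, dWaveSourceEnergyDensityTT'Twist t' U μ x κ = dWaveSourceEnergyDensityTT'Twist t' U μ |x| κ := by
    intro x
    rcases le_total 0 x with hx | hx
    · rw [abs_of_nonneg hx]
    · rw [abs_of_nonpos hx, dWaveSourceEnergyDensityTT'Twist_even t' U μ κ Ls hLs n hn]
  rw [key h, key h']
  exact dWaveSourceEnergyDensityTT'Twist_anti t' U μ κ Ls hLs n hn (abs_nonneg h) hle

include hLs hn in
/-- **Window transport across the sign of the source**: `lo ≤ e^tw(h;κ) ⇒ lo ≤ e^tw(−h;κ)` and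
`e^tw(h;κ) ≤ hi ⇒ e^tw(−h;κ) ≤ hi`. [cite: KomaTasaki1994, §1] -/
theorem dWaveSourceEnergyDensityTT'Twist_neg_mem_of_mem {h lo hi : ℝ}
    (hlo : lo ≤ dWaveSourceEnergyDensityTT'Twist t' U μ h κ) (hhi : dWaveSourceEnergyDensityTT'Twist t' U μ h κ ≤ hi) :
    lo ≤ dWaveSourceEnergyDensityTT'Twist t' U μ (-h) κ ∧ dWaveSourceEnergyDensityTT'Twist t' U μ (-h) κ ≤ hi := by
  rw [dWaveSourceEnergyDensityTT'Twist_even t' U μ κ Ls hLs n hn]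
  exact ⟨hlo, hhi⟩

end Limit

/-! ### §3 The two-sided cusp: PDW order = non-differentiability of `e^tw(·;κ)` at zero source -/

section TwoSided

variable (t' U μ : ℝ) (κ : Fin 2 → Circle) (Ls : ℕ → ℕ) [∀ j, NeZero (Ls j)] (hLs : Tendsto Ls atTop atTop)
  (n : ∀ j, Fin 2 → ZMod (Ls j)) (hn : ∀ j i, ZMod.toCircle (n j i) = κ i)

include hLs hn in
/-- The RIGHT slope of `e^tw(·;κ)` at `0` tends to `−2m⋆_κ` (the cusp identity). [cite: Griffiths1966, §II] -/
theorem tendsto_slope_dWaveSourceEnergyDensityTT'Twist_nhdsGT_zero :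
    Tendsto (slope (fun h => dWaveSourceEnergyDensityTT'Twist t' U μ h κ) 0) (𝓝[>] 0)
      (𝓝 (-2 * dWaveOrderParameterTT'Twist t' U μ κ)) := by
  have key := (tendsto_slope_dWaveOrderParameterTT'Twist t' U μ κ Ls hLs n hn).const_mul (-2)
  refine key.congr' ?_
  filter_upwards [self_mem_nhdsWithin] with h hh
  have hh' : (0 : ℝ) < h := hh
  rw [slope_def_field, sub_zero]
  field_simp
  ring

include hLs hn in
/-- The LEFT slope of `e^tw(·;κ)` at `0` tends to `+2m⋆_κ` (evenness). [cite: Griffiths1966, §II] -/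
theorem tendsto_slope_dWaveSourceEnergyDensityTT'Twist_nhdsLT_zero :
    Tendsto (slope (fun h => dWaveSourceEnergyDensityTT'Twist t' U μ h κ) 0) (𝓝[<] 0)
      (𝓝 (2 * dWaveOrderParameterTT'Twist t' U μ κ)) := by
  have hneg : Tendsto (fun h : ℝ => -h) (𝓝[<] (0 : ℝ)) (𝓝[>] (0 : ℝ)) := by
    simpa using (tendsto_neg_nhdsLT (a := (0 : ℝ)))
  have key := ((tendsto_slope_dWaveOrderParameterTT'Twist t' U μ κ Ls hLs n hn).comp hneg).const_mul 2
  refine key.congr' ?_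
  filter_upwards [self_mem_nhdsWithin] with h hh
  have hh' : h < 0 := hh
  have hne : h ≠ 0 := hh'.ne
  rw [slope_def_field, sub_zero, Function.comp_apply, dWaveSourceEnergyDensityTT'Twist_even t' U μ κ Ls hLs n hn h]
  field_simp
  ring

include hLs hn in
/-- **Differentiability at zero source = no PDW order at `κ`**:
`HasDerivAt (e^tw(·;κ)) e′ 0 ↔ e′ = 0 ∧ m⋆_κ = 0`. [cite: Griffiths1966, §II] -/
theorem hasDerivAt_dWaveSourceEnergyDensityTT'Twist_zero_iff {e' : ℝ} :
    HasDerivAt (fun h => dWaveSourceEnergyDensityTT'Twist t' U μ h κ) e' 0 ↔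
      e' = 0 ∧ dWaveOrderParameterTT'Twist t' U μ κ = 0 := by
  have hL := tendsto_slope_dWaveSourceEnergyDensityTT'Twist_nhdsLT_zero t' U μ κ Ls hLs n hn
  have hR := tendsto_slope_dWaveSourceEnergyDensityTT'Twist_nhdsGT_zero t' U μ κ Ls hLs n hn
  rw [hasDerivAt_iff_tendsto_slope_left_right]
  constructor
  · rintro ⟨hl, hr⟩
    have h1 := tendsto_nhds_unique hl hL
    have h2 := tendsto_nhds_unique hr hR
    constructor <;> linarith
  · rintro ⟨rfl, h0⟩
    rw [h0, mul_zero] at hL hR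
    exact ⟨hL, hR⟩

include hLs hn in
/-- **Pair-density-wave order at bond phase `κ` IS non-differentiability of the twisted sourced energy density at zero
source**: `0 < m⋆_κ ↔ ¬ DifferentiableAt ℝ (e^tw(t',U,μ,·;κ)) 0`. [cite: KomaTasaki1994, §1] -/
theorem dWaveOrderParameterTT'Twist_pos_iff_not_differentiableAt :
    0 < dWaveOrderParameterTT'Twist t' U μ κ ↔
      ¬ DifferentiableAt ℝ (fun h => dWaveSourceEnergyDensityTT'Twist t' U μ h κ) 0 := by
  constructor
  · intro hpos hd
    have h0 := ((hasDerivAt_dWaveSourceEnergyDensityTT'Twist_zero_iff t' U μ κ Ls hLs n hn).1 hd.hasDerivAt).2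
    exact hpos.ne' h0
  · intro hnd
    rcases (dWaveOrderParameterTT'Twist_nonneg t' U μ κ Ls hLs n hn).eq_or_lt with h0 | hpos
    · exact absurd ((hasDerivAt_dWaveSourceEnergyDensityTT'Twist_zero_iff t' U μ κ Ls hLs n hn).2
        ⟨rfl, h0.symm⟩).differentiableAt hnd
    · exact hpos

include hLs hn in
/-- Equivalently: NO PDW order at `κ` iff `e^tw(·;κ)` is differentiable at zero source — and then the derivative there
is `0`. [cite: KomaTasaki1994, §1] -/
theorem dWaveOrderParameterTT'Twist_eq_zero_iff_hasDerivAt :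
    dWaveOrderParameterTT'Twist t' U μ κ = 0 ↔ HasDerivAt (fun h => dWaveSourceEnergyDensityTT'Twist t' U μ h κ) 0 0 := by
  rw [hasDerivAt_dWaveSourceEnergyDensityTT'Twist_zero_iff t' U μ κ Ls hLs n hn]
  exact ⟨fun h => ⟨rfl, h⟩, fun h => h.2⟩

include hLs hn in
/-- **A window at a NEGATIVE source caps the PDW order parameter as well**: for `h > 0`,
`m⋆_κ ≤ (e^tw(0;κ) − e^tw(−h;κ))/(2h)`. [cite: KomaTasaki1994, §1] -/
theorem dWaveOrderParameterTT'Twist_le_slope_neg {h : ℝ} (hh : 0 < h) :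
    dWaveOrderParameterTT'Twist t' U μ κ ≤
      (dWaveSourceEnergyDensityTT'Twist t' U μ 0 κ - dWaveSourceEnergyDensityTT'Twist t' U μ (-h) κ) / (2 * h) := by
  rw [dWaveSourceEnergyDensityTT'Twist_even t' U μ κ Ls hLs n hn]
  exact dWaveOrderParameterTT'Twist_le_slope t' U μ κ Ls hLs n hn hh

end TwoSided

end Literature.MathematicalPhysics.QuantumLattice

end
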